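import Summits.HodgeConjecture.CorCM.DihedralReflexSwapReflect
import Summits.HodgeConjecture.CorCM.NonGaloisStabilizer
import Literature.NumberTheory.ComplexMultiplication.CMTypeRankQuadraticTower
import Literature.NumberTheory.ComplexMultiplication.PartialConjugationOfOneConjugate
import Literature.AlgebraicGeometry.Pohlmann1968.SeparatingCMFamilies
import HarnessLib

/-!
# A non-Galois quartic CM field INSIDE a non-Galois octic CM field: the pair is stably nondegenerate for EVERY
# choice of types — a simple CM surface times a simple CM fourfold containing its field

COR-CM (cell `pub-hodgecm2`, binder seat `b16` gen 40, count-neutral claim SxF-ONECONJ (F4)); NEW as stated, hence under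
`Summits/`.  Theorems only; no definition, no named fact, no `sorry`.

`K₀` a quartic CM field NOT Galois over `ℚ` (the field of a simple CM abelian surface of dihedral type), `K₁ ⊇ K₀` an
octic CM field which is not Galois either (i.e. `K₁` is not the Galois closure `L₀` of `K₀`).  No criterion of the tree
applies to the pair of slots `(K₀; Ψ)`, `(K₁; Θ)`: `K₀ ⊆ L₁`, no partial conjugation exists, and `U(Ψ)` IS a constituent
of `U(Θ)`.  Nevertheless (**`isNondegenerateFamily_iff_of_quarticSubfield`**): for EVERY CM type `Ψ` of `K₀` and every
CM type `Θ` of `K₁`, the pair `(Ψ, Θ)` is nondegenerate iff `Θ` is.  Mechanism: STABILISER SEPARATION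
(`forall_map_slotExt_le_of_stabSep_pair`: an automorphism of `ℂ` stabilising `Θ` and moving `Ψ`, plus the irreducibility
of `U(Ψ)`, `DihedralReflexPair.antiSpan_eq_of_stable`); the separating automorphism comes from the abstract
quadratic-tower theorem `exists_typeStab_and_not_of_quadraticTower` (this seat), whose hypotheses §1 discharges: the
fibres of `Hom(K₁, ℂ) → Hom(K₀, ℂ)` have two elements (`AlgHom.card`), they are swapped by automorphisms of `ℂ` fixing
`L₀` pointwise (one-sided gluing `exists_ringEquiv_apply_eq_of_normal_left` with `L₀ ∩ y(K₁) = y(K₀)`, where `K₁ ⊄ L₀`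
enters), and the dihedral group of `K₀` contains the pair conjugations (`NonGaloisField.exists_ringEquiv_comp_eq_and_comp_ne`).

§1: field theory of the quadratic step; §2: the separating automorphism and the criterion; §3: the Hodge conjecture
and `B• = D•` on every `S^a × F^b` (contrast: for CYCLIC quartic `K₀ ⊂ K₁` every such pair is DEGENERATE,
`CyclicCMSurfaceTimesCMHodge`).

## References

* [MoonenZarhin1999LowDim] B. Moonen, Yu. Zarhin, *Hodge classes on abelian varieties of low dimension*, Math. Ann.
  315 (1999), "Hodge groups of simple abelian surfaces of CM-type" (stabiliser separation one dimension down).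
* [Gordon1999HodgeAVSurvey] B. B. Gordon, *A survey of the Hodge conjecture for abelian varieties*, §3, 7.5–7.7, 10.10.
* [Shimura1998] G. Shimura, *Abelian Varieties with Complex Multiplication and Modular Functions*, §8.4 (2)(C);
  [Kubota1965] T. Kubota, *On the field extension by complex multiplication*, §2; [Lang2002] S. Lang, *Algebra*, V §2, VI §1.
-/

noncomputable section
noncomputable section

open CategoryTheory CategoryTheory.Limits NumberField NumberField.ComplexEmbedding IntermediateField Module
open scoped BigOperators

namespace Summit.HodgeConjecture.CorCM

open Literature.NumberTheory.ComplexMultiplication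
open Literature.AlgebraicGeometry.Motives (AbelianVariety CMType)
open Literature.AlgebraicGeometry.HodgeTheory
open Literature.AlgebraicGeometry.ComplexMultiplication (IsCMTypeRealisation isSimple_iff_isPrimitive)
open Literature.AlgebraicGeometry.VanGeemen1994 (hodgeClassSpan)
open Literature.AlgebraicGeometry.Pohlmann1968
open Literature.Barriers.HodgeConjecture (divisorClassesSpan)

/-! ## §1 Field theory of a quadratic step `k ⊂ L` inside `ℂ` -/

section Fields

variable {k L : Type} [Field k] [NumberField k] [Field L] [NumberField L]

/-- The image of an embedding of a number field is finite over `ℚ`. [folklore] -/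
private theorem finiteDimensional_fieldRange₁₇ (s : L →+* ℂ) : FiniteDimensional ℚ s.toRatAlgHom.fieldRange :=
  LinearEquiv.finiteDimensional (AlgEquiv.ofInjectiveField s.toRatAlgHom).toLinearEquiv

/-- A subfield of a finite extension (inside `ℂ`) is finite. [folklore] -/
private theorem finiteDimensional_of_le₁₇ {F F' : IntermediateField ℚ ℂ} [FiniteDimensional ℚ F] (h : F' ≤ F) :
    FiniteDimensional ℚ F' :=
  FiniteDimensional.of_injective (IntermediateField.inclusion h).toLinearMap (IntermediateField.inclusion_injective h)

/-- `[s(L) : ℚ] = [L : ℚ]`. [folklore] -/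
private theorem finrank_fieldRange₁₇ (s : L →+* ℂ) : finrank ℚ s.toRatAlgHom.fieldRange = finrank ℚ L :=
  (AlgEquiv.ofInjectiveField s.toRatAlgHom).toLinearEquiv.finrank_eq.symm

open scoped Classical in
/-- **Each fibre of `Hom(L, ℂ) → Hom(k, ℂ)`, `y ↦ y ∘ e`, has `[L : k]` elements**: `#{y | y ∘ e = x} · [k : ℚ] = [L : ℚ]`
(the `k`-algebra homomorphisms `L → ℂ` over `x`, counted by `AlgHom.card`). [cite: Lang2002, V §2 Thm. 2.8] -/
theorem card_filter_comp_eq_mul_finrank (e : k →+* L) (x : k →+* ℂ) :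
    (Finset.univ.filter fun y : L →+* ℂ => y.comp e = x).card * finrank ℚ k = finrank ℚ L := by
  classical
  letI : Algebra k L := e.toAlgebra
  letI : Algebra k ℂ := x.toAlgebra
  haveI : IsScalarTower ℚ k L := IsScalarTower.of_algebraMap_eq fun q => (map_ratCast e q).symm
  haveI : FiniteDimensional k L := Module.Finite.of_restrictScalars_finite ℚ k L
  haveI : Algebra.IsSeparable k L := Algebra.IsAlgebraic.isSeparable_of_perfectField
  have hcard : (Finset.univ.filter fun y : L →+* ℂ => y.comp e = x).card = Fintype.card (L →ₐ[k] ℂ) := by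
    rw [← Fintype.card_subtype]
    refine Fintype.card_congr
      { toFun := fun y => { toRingHom := y.1, commutes' := fun a => RingHom.congr_fun y.2 a }
        invFun := fun f => ⟨f.toRingHom, RingHom.ext fun a => f.commutes a⟩
        left_inv := fun y => rfl
        right_inv := fun f => rfl }
  rw [hcard, AlgHom.card k L ℂ, mul_comm, Module.finrank_mul_finrank]

/-- **A quadratic step has fibres of at most two elements**: if `[L : ℚ] = 2 [k : ℚ]` and `y₁ ∘ e = y₂ ∘ e = y₃ ∘ e` then
two of the `yᵢ` coincide. [cite: Lang2002, V §2 Thm. 2.8] -/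
theorem forall_eq_or_eq_comp_eq (e : k →+* L) (h2 : finrank ℚ L = 2 * finrank ℚ k) (y₁ y₂ y₃ : L →+* ℂ)
    (h₁₂ : y₁.comp e = y₂.comp e) (h₂₃ : y₂.comp e = y₃.comp e) : y₁ = y₂ ∨ y₂ = y₃ ∨ y₁ = y₃ := by
  classical
  by_contra hne
  push Not at hne
  obtain ⟨h12, h23, h13⟩ := hne
  have hcard := card_filter_comp_eq_mul_finrank e (y₃.comp e)
  rw [h2] at hcard
  have hk : 0 < finrank ℚ k := finrank_pos
  have h2' : (Finset.univ.filter fun y : L →+* ℂ => y.comp e = y₃.comp e).card = 2 :=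
    Nat.eq_of_mul_eq_mul_right hk (by rw [hcard])
  have hsub : ({y₁, y₂, y₃} : Finset (L →+* ℂ)) ⊆
      Finset.univ.filter fun y : L →+* ℂ => y.comp e = y₃.comp e := by
    intro y hy
    simp only [Finset.mem_insert, Finset.mem_singleton] at hy
    simp only [Finset.mem_filter, Finset.mem_univ, true_and]
    rcases hy with rfl | rfl | rfl
    · rw [h₁₂, h₂₃]
    · rw [h₂₃]
    · rfl
  have h3 : ({y₁, y₂, y₃} : Finset (L →+* ℂ)).card = 3 := by
    rw [Finset.card_insert_of_notMem (by simp [h12, h13]), Finset.card_pair h23]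
  have := Finset.card_le_card hsub
  rw [h3, h2'] at this
  omega

/-- **Every fibre has a second point**: for `[L : ℚ] = 2 [k : ℚ]` and `y : L → ℂ` some `y' ≠ y` has `y' ∘ e = y ∘ e`.
[cite: Lang2002, V §2 Thm. 2.8] -/
theorem exists_ne_comp_eq (e : k →+* L) (h2 : finrank ℚ L = 2 * finrank ℚ k) (y : L →+* ℂ) :
    ∃ y' : L →+* ℂ, y' ≠ y ∧ y'.comp e = y.comp e := by
  classical
  have hcard := card_filter_comp_eq_mul_finrank e (y.comp e)
  rw [h2] at hcard
  have hk : 0 < finrank ℚ k := finrank_pos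
  have h2' : (Finset.univ.filter fun y' : L →+* ℂ => y'.comp e = y.comp e).card = 2 :=
    Nat.eq_of_mul_eq_mul_right hk (by rw [hcard])
  obtain ⟨y', hy', hne⟩ := Finset.exists_mem_ne (by rw [h2']; norm_num) y
  exact ⟨y', hne, (Finset.mem_filter.1 hy').2⟩

/-- **`L₀ ∩ y(L) = y(e(k))` when `y(L) ⊄ L₀`** (`L₀` the Galois closure of `k` in `ℂ`, `[L : ℚ] = 2[k : ℚ]`): the
intermediate field `y(e(k)) ≤ L₀ ∩ y(L) ≤ y(L)` has index `2` in `y(L)`, so the middle term is one of the ends, and it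
is not `y(L)`. [cite: Lang2002, VI §1 Thm. 1.12] -/
theorem mem_fieldRange_comp_of_not_le (e : k →+* L) (h2 : finrank ℚ L = 2 * finrank ℚ k) (y : L →+* ℂ)
    (hout : ¬ y.toRatAlgHom.fieldRange ≤ normalClosure ℚ k ℂ) {z : ℂ} (hz₀ : z ∈ normalClosure ℚ k ℂ)
    (hz₁ : z ∈ y.toRatAlgHom.fieldRange) : z ∈ (y.comp e).toRatAlgHom.fieldRange := by
  haveI : FiniteDimensional ℚ y.toRatAlgHom.fieldRange := finiteDimensional_fieldRange₁₇ y
  haveI : FiniteDimensional ℚ ↥(normalClosure ℚ k ℂ ⊓ y.toRatAlgHom.fieldRange) := finiteDimensional_of_le₁₇ inf_le_right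
  have hle₁ : (y.comp e).toRatAlgHom.fieldRange ≤ normalClosure ℚ k ℂ ⊓ y.toRatAlgHom.fieldRange := by
    refine le_inf (AlgHom.fieldRange_le_normalClosure _) ?_
    rintro _ ⟨a, rfl⟩
    exact ⟨e a, rfl⟩
  have hle₂ : normalClosure ℚ k ℂ ⊓ y.toRatAlgHom.fieldRange ≤ y.toRatAlgHom.fieldRange := inf_le_right
  have hk : finrank ℚ (y.comp e).toRatAlgHom.fieldRange = finrank ℚ k := finrank_fieldRange₁₇ (L := k) (y.comp e)
  have hL : finrank ℚ y.toRatAlgHom.fieldRange = 2 * finrank ℚ k := (finrank_fieldRange₁₇ y).trans h2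
  have hd₁ : finrank ℚ k ∣ finrank ℚ ↥(normalClosure ℚ k ℂ ⊓ y.toRatAlgHom.fieldRange) :=
    hk ▸ IntermediateField.finrank_dvd_of_le_right hle₁
  have hd₂ : finrank ℚ ↥(normalClosure ℚ k ℂ ⊓ y.toRatAlgHom.fieldRange) ∣ 2 * finrank ℚ k :=
    hL ▸ IntermediateField.finrank_dvd_of_le_right hle₂
  have hne : finrank ℚ ↥(normalClosure ℚ k ℂ ⊓ y.toRatAlgHom.fieldRange) ≠ 2 * finrank ℚ k := by
    intro h
    apply hout
    have heq := IntermediateField.eq_of_le_of_finrank_eq hle₂ (by rw [h, hL])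
    exact heq ▸ inf_le_left
  have hkpos : 0 < finrank ℚ k := finrank_pos
  have hdeg : finrank ℚ ↥(normalClosure ℚ k ℂ ⊓ y.toRatAlgHom.fieldRange) = finrank ℚ k := by
    obtain ⟨a, ha⟩ := hd₁
    obtain ⟨b, hb⟩ := hd₂
    rw [ha] at hb hne ⊢
    have hab : a * b = 2 := by
      have : finrank ℚ k * (a * b) = finrank ℚ k * 2 := by rw [← mul_assoc, ← hb, mul_comm]
      exact Nat.eq_of_mul_eq_mul_left hkpos this
    have ha2 : a ≠ 2 := fun h => hne (by rw [h, mul_comm])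
    have ha1 : a = 1 := by
      have hdvd : a ∣ 2 := ⟨b, hab.symm⟩
      have hle : a ≤ 2 := Nat.le_of_dvd two_pos hdvd
      interval_cases a <;> simp_all
    rw [ha1, mul_one]
  have heq := IntermediateField.eq_of_le_of_finrank_eq hle₁ (by rw [hdeg, hk])
  rw [heq]
  exact ⟨hz₀, hz₁⟩

/-- **Fibre swaps trivial on `L₀`.**  If `y(L) ⊄ L₀` (`[L : ℚ] = 2[k : ℚ]`), some `n ∈ Aut(ℂ)` fixes every embedding of
`k` and moves `y` (to the other point of its fibre): transport `y` to its fibre mate by an automorphism `τ` of `ℂ`,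
which fixes `L₀ ∩ y(L) = y(e(k))` pointwise, and correct `τ` by the one-sided gluing lemma so as to fix `L₀`.
[cite: Lang2002, VI §1 Thm. 1.12] -/
theorem exists_fibreSwap_of_not_le (e : k →+* L) (h2 : finrank ℚ L = 2 * finrank ℚ k) (y : L →+* ℂ)
    (hout : ¬ y.toRatAlgHom.fieldRange ≤ normalClosure ℚ k ℂ) :
    ∃ n : ℂ ≃+* ℂ, (∀ s : k →+* ℂ, n • s = s) ∧ n • y ≠ y := by
  obtain ⟨y', hne, hy'⟩ := exists_ne_comp_eq e h2 y
  haveI := isPretransitive_ringEquiv_complex (K := L)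
  obtain ⟨τ, hτ⟩ := MulAction.exists_smul_eq (ℂ ≃+* ℂ) y y'
  haveI : @Normal ℚ ↥(normalClosure ℚ k ℂ) _ _ (IntermediateField.algebra' _) :=
    normal_normalClosure_complex (I := Unit) (K := fun _ => k) ()
  haveI : FiniteDimensional ℚ y.toRatAlgHom.fieldRange := finiteDimensional_fieldRange₁₇ y
  -- `τ⁻¹` fixes `L₀ ∩ y(L) = y(e(k))` pointwise
  have hfix : ∀ z : ℂ, z ∈ normalClosure ℚ k ℂ → z ∈ y.toRatAlgHom.fieldRange → τ.symm z = z := by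
    intro z hz₀ hz₁
    obtain ⟨a, rfl⟩ := AlgHom.mem_fieldRange.1 (mem_fieldRange_comp_of_not_le e h2 y hout hz₀ hz₁)
    change τ.symm (y (e a)) = y (e a)
    have h1 : τ (y (e a)) = y (e a) := by
      rw [← ringEquiv_smul_apply τ y (e a), hτ]
      exact RingHom.congr_fun hy' a
    nth_rewrite 1 [← h1]
    rw [RingEquiv.symm_apply_apply]
  obtain ⟨τ₁, hA, hM⟩ := exists_ringEquiv_apply_eq_of_normal_left (A := normalClosure ℚ k ℂ)
    (M := y.toRatAlgHom.fieldRange) τ.symm hfix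
  refine ⟨τ * τ₁, fun s => RingHom.ext fun a => ?_, ?_⟩
  · rw [ringEquiv_smul_apply]
    change τ (τ₁ (s a)) = s a
    rw [hA _ (apply_mem_normalClosure (I := Unit) (K := fun _ => k) () s a), RingEquiv.apply_symm_apply]
  · have hτ₁y : τ₁ • y = y := RingHom.ext fun a => by
      rw [ringEquiv_smul_apply]; exact hM _ (AlgHom.mem_fieldRange.2 ⟨a, rfl⟩)
    rw [mul_smul, hτ₁y, hτ]
    exact hne

/-- `y(L) ⊄ L₀` when `L` is not Galois and `[L : ℚ] ≥ [L₀ : ℚ]`: otherwise `y(L) = L₀` would be normal.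
[cite: Lang2002, VI §1 Thm. 1.12] -/
theorem not_fieldRange_le_normalClosure (hL : ¬ IsGalois ℚ L)
    (hdeg : finrank ℚ ↥(normalClosure ℚ k ℂ) ≤ finrank ℚ L) (y : L →+* ℂ) :
    ¬ y.toRatAlgHom.fieldRange ≤ normalClosure ℚ k ℂ := by
  intro hle
  haveI : FiniteDimensional ℚ y.toRatAlgHom.fieldRange := finiteDimensional_fieldRange₁₇ y
  have heq : y.toRatAlgHom.fieldRange = normalClosure ℚ k ℂ :=
    IntermediateField.eq_of_le_of_finrank_le hle (by rw [finrank_fieldRange₁₇]; exact hdeg)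
  haveI hG : IsGalois ℚ ↥(normalClosure ℚ k ℂ) := isGalois_normalClosure_complex (I := Unit) (K := fun _ => k) ()
  apply hL
  have e₁ : L ≃ₐ[ℚ] ↥y.toRatAlgHom.fieldRange := AlgEquiv.ofInjectiveField y.toRatAlgHom
  have e₂ : ↥y.toRatAlgHom.fieldRange ≃ₐ[ℚ] ↥(normalClosure ℚ k ℂ) := IntermediateField.equivOfEq heq
  exact IsGalois.of_algEquiv (e₁.trans e₂).symm

variable [IsCMField k]

/-- **Pair conjugations in the dihedral group**: for a NON-GALOIS quartic CM field `k` and embeddings `x`, `x'` with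
`x' ∉ {x, x̄}` some `g ∈ Aut(ℂ)` fixes `x` and conjugates `x'` (the stabiliser of `x` in `Gal(L₀/ℚ) ≅ D₄` is a
reflection swapping `x'`, `x̄'`). [cite: Shimura1998, §8.4 Example (2)(C)] -/
theorem exists_pairConj_of_not_isGalois (h4 : finrank ℚ k = 4) (hk : ¬ IsGalois ℚ k) (Ψ : CMType k)
    {x x' : k →+* ℂ} (hx' : x' ≠ x) (hx'' : x' ≠ (starRingAut : ℂ ≃+* ℂ) • x) :
    ∃ g : ℂ ≃+* ℂ, g • x = x ∧ g • x' = (starRingAut : ℂ ≃+* ℂ) • x' := by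
  have hCM := isCMTypeWith_conj Ψ
  obtain ⟨g, t, hgx, hgt⟩ := NonGaloisField.exists_ringEquiv_comp_eq_and_comp_ne hk x
  have hgx' : g • x = x := hgx
  have hgt' : g • t ≠ t := hgt
  refine ⟨g, hgx', ?_⟩
  -- `g` fixes `x̄`, so `t ∈ {x', x̄'}` and `g` swaps `x'`, `x̄'`
  have hgxb : g • ((starRingAut : ℂ ≃+* ℂ) • x) = (starRingAut : ℂ ≃+* ℂ) • x := by rw [hCM.comm, hgx']
  have hx'b : x' ≠ conjugate x := by rwa [← conj_smul_eq_conjugate]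
  have hgx'ne : g • x' ≠ x := fun h => hx' (smul_left_cancel g (h.trans hgx'.symm))
  have hgx'ne' : g • x' ≠ (starRingAut : ℂ ≃+* ℂ) • x := fun h => hx'' (smul_left_cancel g (h.trans hgxb.symm))
  rcases QuarticCM.eq_or_eq_or_eq_or_eq h4 hx' hx'b (g • x') with h | h | h | h
  · exact absurd h hgx'ne
  · rw [← conj_smul_eq_conjugate] at h; exact absurd h hgx'ne'
  · -- `g` fixes `x'`, hence all four embeddings: contradiction with `g t ≠ t`
    exfalso
    apply hgt'
    rcases QuarticCM.eq_or_eq_or_eq_or_eq h4 hx' hx'b t with rfl | rfl | rfl | rfl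
    · exact hgx'
    · rw [← conj_smul_eq_conjugate, hCM.comm, hgx']
    · exact h
    · rw [← conj_smul_eq_conjugate, hCM.comm, h]
  · rw [← conj_smul_eq_conjugate] at h; exact h

end Fields

/-! ## §2 The separating automorphism and the rank -/

section Types

variable {I : Type} {K : I → Type} [∀ i, Field (K i)] [∀ i, NumberField (K i)] [∀ i, IsCMField (K i)] [Fintype I]
  [DecidableEq I]

omit [Fintype I] [DecidableEq I] in
/-- **An automorphism of `ℂ` stabilising `Θ = Φ_{i₁}` and moving `Ψ = Φ_{i₀}`** for a non-Galois quartic CM field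
`K_{i₀}` embedded in a CM field `K_{i₁}` with `[K_{i₁} : ℚ] = 8`, no conjugate of which lies in the Galois closure of
`K_{i₀}`, and `Φ_{i₁}` nondegenerate (the quadratic-tower theorem on `Hom(K_{i₁}, ℂ) → Hom(K_{i₀}, ℂ)`).
[cite: Kubota1965, §2] [cite: Shimura1998, §8.4 Example (2)(C)] -/
theorem exists_typeStab_and_not_of_quarticSubfield {i₀ i₁ : I} (Φ : ∀ i, CMType (K i))
    (h4 : finrank ℚ (K i₀) = 4) (hK₀ : ¬ IsGalois ℚ (K i₀)) (e : K i₀ →+* K i₁) (h8 : finrank ℚ (K i₁) = 8)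
    (hout : ∀ y : K i₁ →+* ℂ, ¬ y.toRatAlgHom.fieldRange ≤ normalClosure ℚ (K i₀) ℂ)
    (hnd : IsNondegenerate (Φ i₁)) :
    ∃ g : ℂ ≃+* ℂ, (∀ y : K i₁ →+* ℂ, g • y ∈ (Φ i₁).1 ↔ y ∈ (Φ i₁).1) ∧
      ∃ x : K i₀ →+* ℂ, ¬(g • x ∈ (Φ i₀).1 ↔ x ∈ (Φ i₀).1) := by
  classical
  have h2 : finrank ℚ (K i₁) = 2 * finrank ℚ (K i₀) := by rw [h8, h4]
  have hnd' : typeRank (ℂ ≃+* ℂ) (Φ i₁).1 = Fintype.card (K i₁ →+* ℂ) / 2 + 1 := by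
    rw [Embeddings.card]; exact hnd
  exact exists_typeStab_and_not_of_quadraticTower (isCMTypeWith_conj (Φ i₀)) (isCMTypeWith_conj (Φ i₁))
    (fun y : K i₁ →+* ℂ => y.comp e) (fun _ _ => rfl)
    (fun y₁ y₂ y₃ h₁₂ h₂₃ => forall_eq_or_eq_comp_eq e h2 y₁ y₂ y₃ h₁₂ h₂₃)
    (fun y => exists_fibreSwap_of_not_le e h2 y (hout y))
    (fun x x' hx' hx'' z => by
      rw [conj_smul_eq_conjugate] at hx'' ⊢; rw [conj_smul_eq_conjugate]
      exact QuarticCM.eq_or_eq_or_eq_or_eq h4 hx' hx'' z)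
    (fun x x' hx' hx'' => exists_pairConj_of_not_isGalois h4 hK₀ (Φ i₀) hx' hx'') hnd'

omit [∀ i, IsCMField (K i)] [DecidableEq I] in
/-- `|⊔_i Hom(K_i, ℂ)| = Σ_i [K_i : ℚ]`. [folklore] -/
private theorem card_sigma_ringHom_eq_sum₁₇ :
    Fintype.card ((i : I) × (K i →+* ℂ)) = ∑ i, finrank ℚ (K i) := by
  rw [Fintype.card_sigma]
  exact Finset.sum_congr rfl fun i _ => Embeddings.card (K i) ℂ

/-- **The pair is nondegenerate iff `Θ` is.**  `K_{i₀}` a NON-Galois quartic CM field, `K_{i₁} ⊇ K_{i₀}` a CM field of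
degree `8` no conjugate of which lies in the Galois closure of `K_{i₀}` (e.g. `K_{i₁}` not Galois): for EVERY pair of
types, `(Φ_{i₀}, Φ_{i₁})` is nondegenerate iff `Φ_{i₁}` is — by stabiliser separation at the quartic slot (whose `U`
is irreducible), although the two slots share a constituent. [cite: MoonenZarhin1999LowDim, "Hodge groups of simple abelian surfaces of CM-type"]
[cite: Gordon1999HodgeAVSurvey, 7.5] -/
theorem isNondegenerateFamily_iff_of_quarticSubfield {i₀ i₁ : I} (h01 : i₀ ≠ i₁) (hI : ∀ j, j = i₀ ∨ j = i₁)
    (Φ : ∀ i, CMType (K i)) (h4 : finrank ℚ (K i₀) = 4) (hK₀ : ¬ IsGalois ℚ (K i₀)) (e : K i₀ →+* K i₁)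
    (h8 : finrank ℚ (K i₁) = 8)
    (hout : ∀ y : K i₁ →+* ℂ, ¬ y.toRatAlgHom.fieldRange ≤ normalClosure ℚ (K i₀) ℂ) :
    CMAlgebra.IsNondegenerateFamily Φ ↔ IsNondegenerate (Φ i₁) := by
  classical
  haveI : Nonempty I := ⟨i₀⟩
  refine ⟨fun hnd => hnd.isNondegenerate i₁, fun hnd => ?_⟩
  obtain ⟨g, hg0, x, hgx⟩ := exists_typeStab_and_not_of_quarticSubfield Φ h4 hK₀ e h8 hout hnd
  have hI' : ∀ j, j = i₁ ∨ j = i₀ := fun j => (hI j).symm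
  have key := typeRank_sigmaType_eq_iff_forall_of_stabSep_pair (G := ℂ ≃+* ℂ) (E := fun i => K i →+* ℂ)
    (Φ := fun i => (Φ i).1) (ρ := (starRingAut : ℂ ≃+* ℂ)) (g := g) i₀ (fun i => isCMTypeWith_conj (Φ i)) hI'
    h01.symm (fun i hi y => by
      rcases hI i with rfl | rfl
      · exact absurd rfl hi
      · exact hg0 y) ⟨x, hgx⟩
    (fun W hW hne hst => DihedralReflexPair.antiSpan_eq_of_stable h4 hK₀ (Φ i₀) W hW hne hst)
  have key' : CMAlgebra.IsNondegenerateFamily Φ ↔ ∀ i, IsNondegenerate (Φ i) := by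
    rw [CMAlgebra.isNondegenerateFamily_iff, ← card_sigma_ringHom_eq_sum₁₇ (K := K)]
    refine key.trans (forall_congr' fun i => ?_)
    rw [isNondegenerate_iff, cmTypeRank, ← Embeddings.card (K i) ℂ]
  rw [key']
  intro i
  rcases hI i with rfl | rfl
  · exact QuarticCM.isNondegenerate_of_not_isGalois h4 hK₀ (Φ i)
  · exact hnd

/-- **… for a non-Galois octic `K_{i₁}`**: no conjugate of `K_{i₁}` lies in the (degree-`8`, Galois) closure of `K_{i₀}`.
[cite: MoonenZarhin1999LowDim, "Hodge groups of simple abelian surfaces of CM-type"] [cite: Gordon1999HodgeAVSurvey, 7.5] -/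
theorem isNondegenerateFamily_iff_of_quarticSubfield_of_not_isGalois {i₀ i₁ : I} (h01 : i₀ ≠ i₁)
    (hI : ∀ j, j = i₀ ∨ j = i₁) (Φ : ∀ i, CMType (K i)) (h4 : finrank ℚ (K i₀) = 4) (hK₀ : ¬ IsGalois ℚ (K i₀))
    (e : K i₀ →+* K i₁) (h8 : finrank ℚ (K i₁) = 8) (hK₁ : ¬ IsGalois ℚ (K i₁)) :
    CMAlgebra.IsNondegenerateFamily Φ ↔ IsNondegenerate (Φ i₁) :=
  isNondegenerateFamily_iff_of_quarticSubfield h01 hI Φ h4 hK₀ e h8 fun y =>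
    not_fieldRange_le_normalClosure hK₁ (by rw [DihedralReflexPair.finrank_normalClosure_eq_eight h4 hK₀, h8]) y

end Types

/-! ## §3 Geometry: every `S^a × F^b` -/

section Geometry

variable {I : Type} {K : I → Type} [∀ i, Field (K i)] [∀ i, NumberField (K i)] [∀ i, IsCMField (K i)] [Fintype I]
  [DecidableEq I] {Φ : ∀ i, CMType (K i)}
variable {A : I → AbelianVariety ℂ} {ι : ∀ i, 𝓞 (K i) →+* End (A i)}
  {θ : ∀ i, K i →+* Module.End ℂ (complexBetti (A i).X 1)}

/-- **A CM abelian surface `S` with NON-Galois quartic field `K₀` times a realisation `F` of a nondegenerate CM type of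
a non-Galois OCTIC field `K₁ ⊇ K₀`: the Hodge conjecture and `B• = D•` on EVERY `S^a × F^b`** (every
`⨁_{j<N} A_{π j}`), UNCONDITIONALLY — for every type of `S`.
[cite: Gordon1999HodgeAVSurvey, 7.5 and 10.10] [cite: MoonenZarhin1999LowDim, "Hodge groups of simple abelian surfaces of CM-type"] -/
theorem hodgeConjectureFor_prod_of_quarticSubfield {i₀ i₁ : I} (h01 : i₀ ≠ i₁) (hI : ∀ j, j = i₀ ∨ j = i₁)
    (h4 : finrank ℚ (K i₀) = 4) (hK₀ : ¬ IsGalois ℚ (K i₀)) (e : K i₀ →+* K i₁) (h8 : finrank ℚ (K i₁) = 8)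
    (hK₁ : ¬ IsGalois ℚ (K i₁)) (hΦ₁ : IsNondegenerate (Φ i₁))
    (hA : ∀ i, IsCMTypeRealisation (Φ i) (A i) (ι i) (θ i)) {N : ℕ} (π : Fin N → I) :
    HodgeConjectureFor (⨁ fun j : Fin N => A (π j)).dim (⨁ fun j : Fin N => A (π j)).X ∧
      ∀ m : ℕ, hodgeClassSpan (⨁ fun j : Fin N => A (π j)).dim (⨁ fun j : Fin N => A (π j)).X m =
        divisorClassesSpan (⨁ fun j : Fin N => A (π j)).X (⨁ fun j : Fin N => A (π j)).dim m :=
  haveI : Nonempty I := ⟨i₀⟩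
  have hnd := (isNondegenerateFamily_iff_of_quarticSubfield_of_not_isGalois h01 hI Φ h4 hK₀ e h8 hK₁).2 hΦ₁
  ⟨hnd.hodgeConjectureFor_prod hA π, fun m => hnd.hodgeClassSpan_prod_eq_divisorClassesSpan hA π m⟩

omit [∀ i, IsCMField (K i)] [Fintype I] [DecidableEq I] in
/-- Number fields of different degrees are not isomorphic. [folklore] -/
private theorem finrank_eq_of_ringEquiv₁₇ {i j : I} (f : K i ≃+* K j) : finrank ℚ (K i) = finrank ℚ (K j) :=
  (AlgEquiv.ofRingEquiv (f := f) fun q => by rw [eq_ratCast]; exact map_ratCast f q).toLinearEquiv.finrank_eq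

/-- **The dichotomy on the varieties** (`S` a simple CM surface with non-Galois field `K₀`, `F` a SIMPLE CM fourfold with
CM by a non-Galois octic `K₁ ⊇ K₀`): `B• = D•` on ALL `S^a × F^b` iff the type of `F` is nondegenerate — the type of
`S` plays no role.  [cite: MoonenZarhin1999LowDim, Thm. (0.2)] [cite: Gordon1999HodgeAVSurvey, 7.5] -/
theorem forall_prod_hodgeClassSpan_eq_iff_of_quarticSubfield {i₀ i₁ : I} (h01 : i₀ ≠ i₁)
    (hI : ∀ j, j = i₀ ∨ j = i₁) (h4 : finrank ℚ (K i₀) = 4) (hK₀ : ¬ IsGalois ℚ (K i₀)) (e : K i₀ →+* K i₁)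
    (h8 : finrank ℚ (K i₁) = 8) (hK₁ : ¬ IsGalois ℚ (K i₁))
    (hA : ∀ i, IsCMTypeRealisation (Φ i) (A i) (ι i) (θ i)) (hs : ∀ i, (A i).IsSimple) :
    (∀ (N : ℕ) (π : Fin N → I) (m : ℕ),
      hodgeClassSpan (⨁ fun j : Fin N => A (π j)).dim (⨁ fun j : Fin N => A (π j)).X m =
        divisorClassesSpan (⨁ fun j : Fin N => A (π j)).X (⨁ fun j : Fin N => A (π j)).dim m) ↔
      IsNondegenerate (Φ i₁) := by
  haveI : Nonempty I := ⟨i₀⟩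
  have hsep : CMAlgebra.IsSeparatingFamily Φ := by
    refine CMAlgebra.isSeparatingFamily_of_isPrimitive
      (fun i s₀ => (isSimple_iff_isPrimitive (hA i) s₀).1 (hs i)) fun i j f _ => ?_
    have hij := finrank_eq_of_ringEquiv₁₇ f
    rcases hI i with rfl | rfl <;> rcases hI j with rfl | rfl
    · rfl
    · rw [h4, h8] at hij; omega
    · rw [h4, h8] at hij; omega
    · rfl
  rw [← CMAlgebra.isNondegenerateFamily_iff_forall_prod_hodgeClassSpan_eq hsep hA]
  exact isNondegenerateFamily_iff_of_quarticSubfield_of_not_isGalois h01 hI Φ h4 hK₀ e h8 hK₁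

end Geometry

end Summit.HodgeConjecture.CorCM

end
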